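import Summits.NavierStokesRegularity.NavierStokesRegularity.Theorems.SoloRefuteAlneel2026Thm21Fields
import Mathlib.MeasureTheory.Group.LIntegral
import Mathlib.Analysis.Normed.Module.RCLike.Real
import HarnessLib

/-!
# Solo refutation kit — C156 `Alneel2026`, display (6), part 1 (fields): the four-translate witness

D-0090 NS-CLAIMS, refuter kit (ns-claims-refuter-4 g6), filed through a salvage seat (conv. (b)).

M. O. Alneel, *An Elementary Proof of the Clay Navier–Stokes Regularity Conjecture*
(arXiv:2604.06974v3, 14 Apr 2026), Step 6 = display (6), p.2 l.43–49. This file builds the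
witness used by part 2 (`SoloRefuteAlneel2026Disp6`): starting from the one-bump field
`w_N = curl (φ Gs_N)` of the landed kit `SoloRefuteAlneel2026Thm21Fields` (refuter-2 g7) it proves
(1) the exact pointwise identity giving `‖w_N(y)‖² ≥ φ(y)²`, hence `w_N ≠ 0` on the open ball
`B(0,2)` and `supp w_N ⊆ B(0,2)`; (2) `m_N := ∫‖w_N‖² < ∞` with the uniform bound
`m_N ≤ (1 + ‖curlCLM‖K)² |B̄(0,2)|`, `m_N ≥ |B(0,1)|`, and the **strict sub-capture**
`∫_{B(x',r)} ‖w_N‖² < m_N` for every ball of radius `r < 2`; (3) the four-translate datum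
`W_N := curl Σ_{k<4} G_N(· − 20k e₀)` — an admissible datum of the skeleton (`IsDatum`) with
`W_N(x) = Σ_k w_N(x − c_k)`, at most one live translate at each point, and `W_N = w_N` on `B(0,4)`.

WHAT THIS IS NOT: not a claim about NS regularity or blow-up; not a claim about any author
beyond the typed locator. [cite: Alneel2026, display (6) p.2 l.43–49; Thm 2.1 p.1 l.24–28]
-/

open Real Set Function MeasureTheory Metric
open scoped ENNReal NNReal ContDiff Topology

set_option linter.dupNamespace false

namespace Summit.NavierStokesRegularity.NavierStokesRegularity.Theorems.Alneel2026Disp6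

open Literature.Analysis Literature.Analysis.FluidPDE
open Literature.Claims.NS.Alneel2026
open Literature.Claims.NS.Chae2007 (IsDatum)
open Summit.NavierStokesRegularity.NavierStokesRegularity.Theorems.Alneel2026Second

/-! ## 1. The one-bump field does not vanish on `B(0,2)` -/

/-- Leibniz form of `w_N = curl (φ Gs_N)`. [folklore] -/
theorem w_decomp {N : ℝ} (hN : N ≠ 0) (x : E3) :
    w N x = φ x • Ws N x + curlCLM ((fderiv ℝ φ x).smulRight (Gs N x)) := by
  have hφd : DifferentiableAt ℝ φ x := (φ_contDiff.differentiable (by simp)).differentiableAt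
  have hGd : DifferentiableAt ℝ (Gs N) x :=
    ((contDiff_Gs N).differentiable (by simp)).differentiableAt
  have hw : w N x = φ x • curl (Gs N) x + curlCLM ((fderiv ℝ φ x).smulRight (Gs N x)) :=
    curl_smul hφd hGd
  rw [curl_Gs hN] at hw
  exact hw

/-- The exact pointwise identity behind `w_N ≠ 0` on `B(0,2)`: the first two components of
`w_N(x)` are `(−φ cos θ − t sin θ, −φ sin θ + t cos θ)` with `θ = N x₂`, `t = ∂₂φ(x)/N`, so
`‖w_N(x)‖² ≥ φ(x)² + t² ≥ φ(x)²`. [folklore] -/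
theorem sq_φ_le_normsq_w {N : ℝ} (hN : N ≠ 0) (x : E3) : φ x ^ 2 ≤ ‖w N x‖ ^ 2 := by
  rw [w_decomp hN x, EuclideanSpace.real_norm_sq_eq, Fin.sum_univ_three]
  set D : E3 →L[ℝ] E3 := (fderiv ℝ φ x).smulRight (Gs N x) with hD
  have hc0 : curlCLM D 0 = D (EuclideanSpace.single 1 1) 2 - D (EuclideanSpace.single 2 1) 1 := by
    simp [curlCLM, curlLM]
  have hc1 : curlCLM D 1 = D (EuclideanSpace.single 2 1) 0 - D (EuclideanSpace.single 0 1) 2 := by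
    simp [curlCLM, curlLM]
  have hDa : ∀ v i, D v i = fderiv ℝ φ x v * Gs N x i := fun v i => by simp [hD]
  have hG0 : Gs N x 0 = N⁻¹ * Real.cos (N * x 2) := by simp [Gs]
  have hG1 : Gs N x 1 = N⁻¹ * Real.sin (N * x 2) := by simp [Gs]
  have hG2 : Gs N x 2 = 0 := by simp [Gs]
  have hW0 : Ws N x 0 = -Real.cos (N * x 2) := by simp [Ws]
  have hW1 : Ws N x 1 = -Real.sin (N * x 2) := by simp [Ws]
  have e0 : (φ x • Ws N x + curlCLM D) 0 = φ x * Ws N x 0 + curlCLM D 0 := by simp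
  have e1 : (φ x • Ws N x + curlCLM D) 1 = φ x * Ws N x 1 + curlCLM D 1 := by simp
  rw [e0, e1, hc0, hc1, hDa, hDa, hDa, hDa, hW0, hW1, hG0, hG1, hG2]
  set g0 := fderiv ℝ φ x (EuclideanSpace.single 0 1)
  set g1 := fderiv ℝ φ x (EuclideanSpace.single 1 1)
  set g2 := fderiv ℝ φ x (EuclideanSpace.single 2 1)
  have hsc := Real.sin_sq_add_cos_sq (N * x 2)
  have key : (φ x * -Real.cos (N * x 2) + (g1 * 0 - g2 * (N⁻¹ * Real.sin (N * x 2)))) ^ 2 +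
      (φ x * -Real.sin (N * x 2) + (g2 * (N⁻¹ * Real.cos (N * x 2)) - g0 * 0)) ^ 2 =
      φ x ^ 2 + (g2 * N⁻¹) ^ 2 := by
    linear_combination (φ x ^ 2 + (g2 * N⁻¹) ^ 2) * hsc
  nlinarith [key, sq_nonneg (g2 * N⁻¹), sq_nonneg ((φ x • Ws N x + curlCLM D) 2)]

/-- `φ > 0` on the open ball `B(0,2)`. [folklore] -/
theorem φ_pos {x : E3} (hx : x ∈ ball (0 : E3) 2) : 0 < φ x :=
  bump.pos_of_mem_ball hx

/-- `w_N ≠ 0` on `B(0,2)` (`N ≠ 0`). [folklore] -/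
theorem norm_w_pos {N : ℝ} (hN : N ≠ 0) {x : E3} (hx : x ∈ ball (0 : E3) 2) : 0 < ‖w N x‖ := by
  have h1 := sq_φ_le_normsq_w hN x
  have h2 := pow_pos (φ_pos hx) 2
  nlinarith [norm_nonneg (w N x)]

/-- `supp w_N ⊆ B(0,2)` (open ball: the support is open and sits inside `B̄(0,2)`). [folklore] -/
theorem support_w_subset (N : ℝ) : support (w N) ⊆ ball (0 : E3) 2 := by
  have h1 : support (w N) ⊆ closedBall (0 : E3) 2 := (subset_tsupport _).trans (tsupport_w_subset N)
  have h2 : IsOpen (support (w N)) := (contDiff_w N).continuous.isOpen_support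
  rw [← interior_closedBall (0 : E3) two_ne_zero]
  exact interior_maximal h1 h2

/-- `w_N(x) = 0` once `‖x‖ ≥ 2`. [folklore] -/
theorem w_eq_zero_of_two_le {N : ℝ} {x : E3} (hx : 2 ≤ ‖x‖) : w N x = 0 := by
  by_contra h
  have := support_w_subset N (mem_support.mpr h)
  rw [mem_ball_zero_iff] at this
  linarith

/-! ## 2. Energy of one bump: finite, bounded, and strictly sub-captured by small balls -/

/-- Measurability of `‖w_N‖ₑ²`. [folklore] -/
theorem measurable_enormsq_w (N : ℝ) : Measurable fun y => ‖w N y‖ₑ ^ 2 :=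
  ((contDiff_w N).continuous.enorm.measurable).pow_const 2

/-- `∫ ‖w_N‖² ≤ (1 + ‖curlCLM‖ K)² |B̄(0,2)|` for `N ≥ 1`. [folklore] -/
theorem lintegral_w_le {K : ℝ} (hK : ∀ x, ‖fderiv ℝ φ x‖ ≤ K) {N : ℝ} (hN : 1 ≤ N) :
    ∫⁻ y, ‖w N y‖ₑ ^ 2 ≤
      ENNReal.ofReal ((1 + ‖curlCLM‖ * K) ^ 2) * volume (closedBall (0 : E3) 2) := by
  have hsub : support (fun y => ‖w N y‖ₑ ^ 2) ⊆ closedBall (0 : E3) 2 := by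
    intro y hy
    have hy' : w N y ≠ 0 := by
      intro h; apply hy; simp [h]
    exact ball_subset_closedBall (support_w_subset N (mem_support.mpr hy'))
  rw [← setLIntegral_eq_of_support_subset hsub]
  calc ∫⁻ y in closedBall (0 : E3) 2, ‖w N y‖ₑ ^ 2
      ≤ ∫⁻ _ in closedBall (0 : E3) 2, ENNReal.ofReal ((1 + ‖curlCLM‖ * K) ^ 2) := by
        refine setLIntegral_mono' measurableSet_closedBall fun y _ => ?_
        rw [← ofReal_norm, ← ENNReal.ofReal_pow (norm_nonneg _)]
        exact ENNReal.ofReal_le_ofReal (pow_le_pow_left₀ (norm_nonneg _) (norm_w_le hK hN y) 2)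
    _ = ENNReal.ofReal ((1 + ‖curlCLM‖ * K) ^ 2) * volume (closedBall (0 : E3) 2) :=
        setLIntegral_const _ _

/-- `∫ ‖w_N‖² < ∞`. [folklore] -/
theorem lintegral_w_lt_top {K : ℝ} (hK : ∀ x, ‖fderiv ℝ φ x‖ ≤ K) {N : ℝ} (hN : 1 ≤ N) :
    ∫⁻ y, ‖w N y‖ₑ ^ 2 < ⊤ :=
  (lintegral_w_le hK hN).trans_lt (ENNReal.mul_lt_top ENNReal.ofReal_lt_top measure_closedBall_lt_top)

/-- `|B(0,1)| ≤ ∫ ‖w_N‖²` (`‖w_N‖ = 1` on the unit ball). [folklore] -/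
theorem volume_ball_le_lintegral_w {N : ℝ} (hN : N ≠ 0) :
    volume (ball (0 : E3) 1) ≤ ∫⁻ y, ‖w N y‖ₑ ^ 2 := by
  calc volume (ball (0 : E3) 1) = ∫⁻ _ in ball (0 : E3) 1, (1 : ℝ≥0∞) := by
        rw [setLIntegral_const, one_mul]
    _ = ∫⁻ y in ball (0 : E3) 1, ‖w N y‖ₑ ^ 2 := by
        refine setLIntegral_congr_fun measurableSet_ball fun y hy => ?_
        rw [w_eq_Ws hN hy, ← ofReal_norm, norm_Ws]
        simp
    _ ≤ ∫⁻ y, ‖w N y‖ₑ ^ 2 := setLIntegral_le_lintegral _ _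

/-- **Strict sub-capture.** A ball of radius `r < 2` captures strictly less than the whole
energy of one bump: the open set `B(0,2) ∖ B̄(x', r)` is non-empty (two antipodal points at
distance `2 + r > 2r`) and `w_N ≠ 0` on it. [folklore] -/
theorem setLIntegral_ball_lt {K : ℝ} (hK : ∀ x, ‖fderiv ℝ φ x‖ ≤ K) {N : ℝ} (hN : 1 ≤ N)
    {r : ℝ} (hr0 : 0 < r) (hr : r < 2) (x' : E3) :
    ∫⁻ y in ball x' r, ‖w N y‖ₑ ^ 2 < ∫⁻ y, ‖w N y‖ₑ ^ 2 := by
  have hN0 : N ≠ 0 := by positivity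
  set U : Set E3 := ball (0 : E3) 2 \ closedBall x' r with hU
  have hUo : IsOpen U := isOpen_ball.sdiff isClosed_closedBall
  have hnorm : ∀ σ : ℝ, ‖σ • e 0‖ = |σ| := fun σ => by
    rw [norm_smul, (by simp [e] : ‖e 0‖ = 1), mul_one, Real.norm_eq_abs]
  have hUne : U.Nonempty := by
    by_contra hne
    rw [Set.not_nonempty_iff_eq_empty] at hne
    set s : ℝ := (2 + r) / 2 with hs
    have hs2 : s < 2 := by rw [hs]; linarith
    have hs0 : 0 < s := by rw [hs]; linarith
    have hmem : ∀ σ : ℝ, |σ| = s → σ • e 0 ∈ closedBall x' r := by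
      intro σ hσ
      by_contra hσ'
      have hin : σ • e 0 ∈ U := ⟨by rw [mem_ball_zero_iff, hnorm, hσ]; exact hs2, hσ'⟩
      rw [hne] at hin
      exact hin
    have h1 := hmem s (abs_of_pos hs0)
    have h2 := hmem (-s) (by rw [abs_neg, abs_of_pos hs0])
    rw [mem_closedBall] at h1 h2
    have h3 : dist (s • e 0) ((-s) • e 0) ≤ r + r :=
      (dist_triangle_right _ _ x').trans (add_le_add h1 h2)
    rw [dist_eq_norm, ← sub_smul, hnorm, sub_neg_eq_add, abs_of_pos (by linarith)] at h3
    rw [hs] at h3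
    linarith
  have hUpos : 0 < volume U := hUo.measure_pos volume hUne
  have hUsub : U ⊆ support fun y => ‖w N y‖ₑ ^ 2 := by
    intro y hy
    have hpos := norm_w_pos hN0 hy.1
    rw [mem_support]
    have : (0 : ℝ≥0∞) < ‖w N y‖ₑ ^ 2 := by
      rw [← ofReal_norm]
      exact ENNReal.pow_pos (ENNReal.ofReal_pos.mpr hpos) 2
    exact this.ne'
  have hUint : 0 < ∫⁻ y in U, ‖w N y‖ₑ ^ 2 := by
    rw [setLIntegral_pos_iff (measurable_enormsq_w N), Set.inter_eq_right.mpr hUsub]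
    exact hUpos
  have hUm : MeasurableSet U := measurableSet_ball.diff measurableSet_closedBall
  have hdisj : Disjoint (ball x' r) U := by
    rw [Set.disjoint_left]
    intro y hy hyU
    exact hyU.2 (ball_subset_closedBall hy)
  have hsum : (∫⁻ y in ball x' r, ‖w N y‖ₑ ^ 2) + ∫⁻ y in U, ‖w N y‖ₑ ^ 2 ≤ ∫⁻ y, ‖w N y‖ₑ ^ 2 := by
    rw [← lintegral_union hUm hdisj]
    exact setLIntegral_le_lintegral _ _
  have hfin : ∫⁻ y in ball x' r, ‖w N y‖ₑ ^ 2 ≠ ⊤ :=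
    ((setLIntegral_le_lintegral _ _).trans_lt (lintegral_w_lt_top hK hN)).ne
  exact (ENNReal.lt_add_right hfin hUint.ne').trans_le hsum

/-! ## 3. Four disjoint translates -/

/-- Centres `c_k = 20k e₀`, `k < 4`. [folklore] -/
noncomputable def c (k : Fin 4) : E3 := ((20 : ℝ) * (k : ℕ)) • e 0

/-- The summed stream field `Σ_k G_N(· − c_k)`. [folklore] -/
noncomputable def Gt (N : ℝ) (x : E3) : E3 := ∑ k : Fin 4, G N (x - c k)

/-- **The witness datum** `W_N := curl Σ_k G_N(· − c_k)`. [folklore] -/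
noncomputable def W (N : ℝ) : E3 → E3 := curl (Gt N)

/-- `c_0 = 0`. [folklore] -/
theorem c_zero : c 0 = 0 := by simp [c]

/-- `‖c_k‖ = 20 k`. [folklore] -/
theorem norm_c (k : Fin 4) : ‖c k‖ = 20 * (k : ℕ) := by
  rw [c, norm_smul, (by simp [e] : ‖e 0‖ = 1), mul_one, Real.norm_eq_abs, abs_of_nonneg (by positivity)]

/-- `‖c_k‖ ≤ 60`. [folklore] -/
theorem norm_c_le (k : Fin 4) : ‖c k‖ ≤ 60 := by
  rw [norm_c]
  have : ((k : ℕ) : ℝ) ≤ 3 := by exact_mod_cast Nat.lt_succ_iff.mp k.isLt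
  linarith

/-- Distinct centres are `≥ 20` apart. [folklore] -/
theorem twenty_le_norm_c_sub {j k : Fin 4} (h : j ≠ k) : 20 ≤ ‖c j - c k‖ := by
  have key : (1 : ℝ) ≤ |((j : ℕ) : ℝ) - ((k : ℕ) : ℝ)| := by
    have hjk : (j : ℕ) ≠ (k : ℕ) := Fin.val_ne_of_ne h
    rcases lt_or_gt_of_ne hjk with hlt | hlt
    · have h' : ((j : ℕ) : ℝ) + 1 ≤ ((k : ℕ) : ℝ) := by exact_mod_cast hlt
      rw [abs_sub_comm, abs_of_nonneg (by linarith)]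
      linarith
    · have h' : ((k : ℕ) : ℝ) + 1 ≤ ((j : ℕ) : ℝ) := by exact_mod_cast hlt
      rw [abs_of_nonneg (by linarith)]
      linarith
  rw [c, c, ← sub_smul, norm_smul, (by simp [e] : ‖e 0‖ = 1), mul_one, ← mul_sub, Real.norm_eq_abs, abs_mul,
    abs_of_pos (by norm_num : (0 : ℝ) < 20)]
  nlinarith [key]

/-- A translate of `G_N` vanishes `> 2` away from its centre. [folklore] -/
theorem G_sub_eq_zero {N : ℝ} {x : E3} {k : Fin 4} (h : 2 < ‖x - c k‖) : G N (x - c k) = 0 :=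
  image_eq_zero_of_notMem_tsupport fun h' => by
    have := tsupport_G_subset N h'
    rw [mem_closedBall_zero_iff] at this
    linarith

/-- A translate of `w_N` vanishes `≥ 2` away from its centre. [folklore] -/
theorem w_sub_eq_zero {N : ℝ} {x : E3} {k : Fin 4} (h : 2 ≤ ‖x - c k‖) : w N (x - c k) = 0 :=
  w_eq_zero_of_two_le h

/-- kit lemma (plumbing). [folklore] -/
theorem contDiff_G_sub (N : ℝ) (k : Fin 4) : ContDiff ℝ ∞ fun y => G N (y - c k) :=
  (contDiff_G N).comp (contDiff_id.sub contDiff_const)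

/-- kit lemma (plumbing). [folklore] -/
theorem contDiff_Gt (N : ℝ) : ContDiff ℝ ∞ (Gt N) := by
  unfold Gt
  exact ContDiff.sum fun k _ => contDiff_G_sub N k

/-- kit lemma (plumbing): `supp Gt_N ⊆ B̄(0, 62)`. [folklore] -/
theorem hasCompactSupport_Gt (N : ℝ) : HasCompactSupport (Gt N) := by
  refine HasCompactSupport.of_support_subset_isCompact (isCompact_closedBall (0 : E3) 62)
    fun x hx => ?_
  rw [mem_closedBall_zero_iff]
  by_contra hx'
  push Not at hx'
  refine (mem_support.mp hx) ?_
  show ∑ k : Fin 4, G N (x - c k) = 0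
  refine Finset.sum_eq_zero fun k _ => G_sub_eq_zero ?_
  have h1 := norm_sub_norm_le x (c k)
  have h2 := norm_c_le k
  linarith

/-- kit lemma (plumbing). [folklore] -/
theorem contDiff_W (N : ℝ) : ContDiff ℝ ∞ (W N) :=
  contDiff_curl ((contDiff_Gt N).of_le (by exact_mod_cast le_top))

/-- kit lemma (plumbing). [folklore] -/
theorem hasCompactSupport_W (N : ℝ) : HasCompactSupport (W N) :=
  hasCompactSupport_curl (hasCompactSupport_Gt N)

/-- kit lemma (plumbing). [folklore] -/
theorem isDivFree_W (N : ℝ) : VectorCalculus.IsDivFree (W N) := fun x =>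
  divergence_curl_eq_zero_holds (Gt N) ((contDiff_Gt N).of_le (WithTop.coe_le_coe.mpr le_top)) x

/-- `W_N` is an admissible datum of the skeleton (`C^∞`, divergence-free, every derivative in
`L²` — compact support). [folklore] -/
theorem isDatum_W (N : ℝ) : IsDatum (W N) :=
  isDatum_of_hasCompactSupport (contDiff_W N) (isDivFree_W N) (hasCompactSupport_W N)

/-- `W_N(x) = Σ_k w_N(x − c_k)` (curl of a finite sum of translates). [folklore] -/
theorem W_apply (N : ℝ) (x : E3) : W N x = ∑ k : Fin 4, w N (x - c k) := by
  have hd : ∀ k ∈ (Finset.univ : Finset (Fin 4)), DifferentiableAt ℝ (fun y => G N (y - c k)) x :=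
    fun k _ => ((contDiff_G_sub N k).differentiable (by simp)).differentiableAt
  show curl (Gt N) x = _
  rw [curl_eq_curlCLM]
  unfold Gt
  rw [fderiv_fun_sum hd, map_sum]
  refine Finset.sum_congr rfl fun k _ => ?_
  rw [fderiv_comp_sub]
  rfl

/-- **At most one translate is alive at each point.** [folklore] -/
theorem exists_others_zero (N : ℝ) (x : E3) : ∃ k : Fin 4, ∀ j, j ≠ k → w N (x - c j) = 0 := by
  by_cases h : ∃ k : Fin 4, ‖x - c k‖ < 2
  · obtain ⟨k, hk⟩ := h
    refine ⟨k, fun j hj => w_sub_eq_zero ?_⟩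
    have h1 := twenty_le_norm_c_sub hj
    -- ‖c j - c k‖ ≤ ‖x - c j‖ + ‖x - c k‖
    have h2 : ‖c j - c k‖ ≤ ‖x - c j‖ + ‖x - c k‖ := by
      have : c j - c k = (x - c k) - (x - c j) := by abel
      rw [this]
      exact (norm_sub_le _ _).trans (by rw [add_comm])
    linarith
  · push Not at h
    exact ⟨0, fun j _ => w_sub_eq_zero (h j)⟩

/-- `‖W_N(x)‖ₑ² = Σ_k ‖w_N(x − c_k)‖ₑ²` (one live term on each side). [folklore] -/
theorem enormsq_W (N : ℝ) (x : E3) : ‖W N x‖ₑ ^ 2 = ∑ k : Fin 4, ‖w N (x - c k)‖ₑ ^ 2 := by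
  obtain ⟨k, hk⟩ := exists_others_zero N x
  rw [W_apply, Finset.sum_eq_single k (fun j _ hj => hk j hj) (fun h => (h (Finset.mem_univ _)).elim),
    Finset.sum_eq_single k (fun j _ hj => by rw [hk j hj]; simp)
      (fun h => (h (Finset.mem_univ _)).elim)]

/-- `W_N = w_N` on `B(0,4)`. [folklore] -/
theorem W_eq_w {N : ℝ} {x : E3} (hx : x ∈ ball (0 : E3) 4) : W N x = w N x := by
  rw [W_apply, Finset.sum_eq_single (0 : Fin 4) (fun j _ hj => w_sub_eq_zero ?_)
    (fun h => (h (Finset.mem_univ _)).elim), c_zero, sub_zero]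
  rw [mem_ball_zero_iff] at hx
  have h1 := norm_sub_norm_le (c j) x
  rw [norm_sub_rev] at h1
  have h2 : (20 : ℝ) ≤ ‖c j‖ := by
    rw [norm_c]
    have : (1 : ℕ) ≤ (j : ℕ) := Nat.one_le_iff_ne_zero.mpr fun h0 => hj (Fin.ext h0)
    have : (1 : ℝ) ≤ ((j : ℕ) : ℝ) := by exact_mod_cast this
    linarith
  linarith

/-- `DW_N = Dw_N` on `B(0,4)`. [folklore] -/
theorem fderiv_W_eq {N : ℝ} {x : E3} (hx : x ∈ ball (0 : E3) 4) :
    fderiv ℝ (W N) x = fderiv ℝ (w N) x :=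
  Filter.EventuallyEq.fderiv_eq
    (Filter.eventuallyEq_of_mem (isOpen_ball.mem_nhds hx) fun _ hy => W_eq_w hy)

end Summit.NavierStokesRegularity.NavierStokesRegularity.Theorems.Alneel2026Disp6
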